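import Summits.QuantumFields.BalabanUV.T4Continuum.Support.NE3QuadRemainderSup
import Summits.QuantumFields.BalabanUV.T4Continuum.Support.NE3LinearisedAverageSup
import Summits.QuantumFields.BalabanUV.T4Continuum.Support.NE7SegmentPlaquetteRadius
import Summits.QuantumFields.BalabanUV.T4Continuum.Support.NE3EnergyHessBilin
import Summits.QuantumFields.BalabanUV.T4Continuum.Support.AveragingDeficitMultiLevelBridge
import Summits.QuantumFields.BalabanUV.T4Continuum.Support.NE3CpushGaugeCovariance
import Summits.QuantumFields.BalabanUV.T4Continuum.Support.BlockAverageCurrent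
import HarnessLib

/-!
# NE7CoarseCurvatureLetter — THE COARSE CURVATURE LETTER ĝ OF F38's BUNDLE IN KERNEL: at a flat reference whose `(k+1)`-fold average is flat,
# the linearised average `φ = D_{F̃}A` of the representative has coarse curvature `‖(d_F φ)(P)‖ ≤ β′ + c″·(Mα₀)²`, `β′` the datum's radius —
# row NE3's k-fold quadratic remainder (Π-C-3b) and sup letter (Π-C-1) BY NAME, k-UNIFORM

Cell `pub-balaban`, rung (B)+1 sub-cell t4, lineage `b2b-balaban-t4-ne7-p1`, generation 70 (CRUX PROVER NE7 #1); memo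
`t4/b2b-balaban-t4-ne7-p1-g70/HUNT-H14-APE-FLAT-SKELETON.md` §3 (row ĝ), §5 (3).  File F43 (over row NE3's `NE3QuadRemainderSup`
(`cavgIter_vary_eq_vary_relIter_of_tower`, `relIter_skew_of_tower`, `norm_relIter_sub_dirIter_le` — [Balaban1985Averaging] Prop. 4 (134)–(135) TYPE),
`NE3LinearisedAverageSup.norm_dirIter_le_sup`, `NE3CpushGaugeCovariance.cavgIter_gaugeAct`, gen 66's `NE7SegmentPlaquetteRadius.norm_hol_taylor_le`).
WHY.  In F38 `NE7ApeFlatSkeleton.hape_of_flatLetters` the normal part's curl is `c_N ≤ C_R·ĝ·M⁻²` ((R7): F37 at the trivial flat datum), `ĝ` a bound on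
the COARSE curvature `d_F(D_{F̃}A)` of the linearised average of the representative `A` (`U^u = F̃e^{A}`).  THIS FILE proves `ĝ = β′ + c″α̂²`
(`α̂ = Mα₀`, `β′` = the datum's small-field radius): the `(k+1)`-fold average of `F̃e^{A}` is `F·e^{B}` with `B = relIter L (k+1) F̃ A` (row NE3's
log-coordinate), `‖B − D_{F̃}A‖ ≤ C₂α̂²` (the k-fold quadratic remainder, k-free), `‖D_{F̃}A‖ ≤ c_D·α̂` (the k-free sup letter), the average of the
representative is a gauge transform of the datum (so `β′`-small), and at the FLAT `F` the plaquette deviation of `F e^{B}` controls `d_F B` up to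
`28‖B‖²` (the Taylor bound read backwards).
WHAT ([folklore]; 0 def, 0 sorry).  §0 `prop1Radius_zero`, `radIter_zero`, **`levelSmall_zero`** (the flat background is in EVERY multi-level class,
radius `0`), `curvSum_zero`.  §1 `norm_curlAt_flat_le_hol_sub_one` (`‖(d_F B)(p′)‖ ≤ ‖Fe^{B}(∂p′) − 1‖ + 28b²` at a flat `F`), `norm_curlAt_le_four_mul`.
§2 **`coarseCurl_le`** — `L ≥ 2`; `F̃` unitary `(L^{k+1}·N)`-periodic FLAT with FLAT `(k+1)`-fold average `F`; `A` skew periodic, `‖A‖ ≤ α₀`, in row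
NE3's quadratic-remainder regime `4(3+12d)²·L^{k+1}α₀ ≤ rho0²`; `SmallField (cavgIter L (k+1) (F̃e^{A})) β′` ⟹ at every coarse plaquette
`‖(d_F (D_{F̃}A))(P)‖ ≤ β′ + 28(c_D α̂ + C₂α̂²)² + 4C₂α̂²`, `c_D = 3 + 12d`, `C₂ = 4(3+12d)³∕rho0²`.  §3 `smallField_cavgIter_gaugeAct` — the hypothesis
`SmallField (cavgIter L (k+1) (U^u)) β′` from `cavgIter L (k+1) U = D`, `SmallField D β′`, `u` unitary.
HONEST FRAMING (page 1): composition of row NE3's landed kinematics; the flatness of the AVERAGE of `F̃` is a hypothesis (automatic at the trivial datum: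
`NE3TangentCovariantTower.cavgIter_flat`); nothing of Bałaban's asserted; NOT (APE), NOT ONE-STEP, NOT NE7; spine 0∕9; finite T⁴ rung (B)+1 — NOT infinite
volume, NOT mass gap, NOT Clay.  Continuum YM on T⁴ ⇐ BetaPertH ∧ nine spine estimates (0/9 proved); BetaPertH ⇐ (D1) ∧ (D4) ∧ CAP+tail; G-an2-4 gates
asym, D1 and NE2/3/4.
-/

set_option autoImplicit false

open scoped BigOperators Matrix.Norms.L2Operator
open Finset

namespace Summit.QuantumFields.BalabanUV.T4Continuum.NE7CoarseCurvatureLetter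

open Literature.MathematicalPhysics.QuantumFieldTheory.Balaban1983to89
open B7Prop1Explicit B7Prop2Explicit MatrixLog UnitaryModel
open T4AveragingDeficitWall (IsUnitaryCfg IsSkewDir SmallField vary curlAt vary_zero)
open T4AveragingDeficitWallBoundary (IsPeriodicCfg)
open AveragingDeficitPeriodicCounting (IsPeriodicDir)
open AveragingDeficitMultiLevelPrep (cavgIter radIter LevelSmall tower)
open AveragingDeficitMultiLevelBridge (tower_eq)
open BlockAverageVaryDisc (rho0 rho0_pos)
open NE3TangentCovariantTower (dirIter)
open NE3LinearisedAverageSup (curv curvSum norm_dirIter_le_sup levelData)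
open NE3QuadRemainderTower (relIter)
open NE3QuadRemainderSup (norm_relIter_sub_dirIter_le cavgIter_vary_eq_vary_relIter_of_tower relIter_skew_of_tower)
open NE3HessBounds (bondSqAt norm_curlAt_le)
open NE3EnergyHessBilin (curlAt_add)
open NE7SegmentPlaquetteRadius (norm_hol_taylor_le bondSqAt_le_of_sup)

noncomputable section

variable {d : ℕ} {n : Type*} [Fintype n] [DecidableEq n]

/-! ## §0 The flat background is in every multi-level class (radius `0`) -/

omit [Fintype n] [DecidableEq n] in
/-- `prop1Radius d L 0 = 0`. [folklore] -/
theorem prop1Radius_zero (L : ℕ) : AveragingDeficitTwoLevelPrep.prop1Radius d L 0 = 0 := by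
  simp [AveragingDeficitTwoLevelPrep.prop1Radius]

omit [Fintype n] [DecidableEq n] in
/-- `radIter d L i 0 = 0`. [folklore] -/
theorem radIter_zero (L : ℕ) : ∀ i : ℕ, radIter d L i 0 = 0
  | 0 => rfl
  | i + 1 => by
      show radIter d L i (AveragingDeficitTwoLevelPrep.prop1Radius d L 0) = 0
      rw [prop1Radius_zero, radIter_zero L i]

omit [Fintype n] [DecidableEq n] in
/-- `LevelSmall d L j 0` for every `j` (the flat background is in every multi-level class). [folklore] -/
theorem levelSmall_zero (L : ℕ) : ∀ j : ℕ, LevelSmall d L j 0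
  | 0 => by show AveragingDeficitTwoLevelPrep.twoLevelSmall d L * 0 ≤ 1; simp
  | j + 1 => by
      refine ⟨by simp, ?_⟩
      show LevelSmall d L j (AveragingDeficitTwoLevelPrep.prop1Radius d L 0)
      rw [prop1Radius_zero]; exact levelSmall_zero L j

omit [Fintype n] [DecidableEq n] in
/-- `curvSum d L m 0 = 0`. [folklore] -/
theorem curvSum_zero (L m : ℕ) : curvSum d L m 0 = 0 := by
  unfold curvSum
  refine Finset.sum_eq_zero fun i _ => ?_
  rw [radIter_zero, curv]
  ring

/-! ## §1 The reverse flat Taylor bound and the four-bond bound -/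

/-- **At a FLAT plaquette the dressed curl is within `28b²` of the plaquette deviation**: `‖(d_F B)(p′)‖ ≤ ‖F e^{B}(∂p′) − 1‖ + 28b²` for `‖B‖ ≤ b`
(the Taylor bound `norm_hol_taylor_le` read the other way round). [folklore] -/
theorem norm_curlAt_flat_le_hol_sub_one [Nonempty n] {F : Site d → Fin d → (Matrix n n ℂ)ˣ} (hF : IsUnitaryCfg F) (hF0 : SmallField F 0)
    {B : Site d → Fin d → Matrix n n ℂ} (hB : IsSkewDir B) {b : ℝ} (hBb : ∀ y κ, ‖B y κ‖ ≤ b) (z : Site d) {μ ν : Fin d} (hμν : μ ≠ ν) :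
    ‖curlAt F B z μ ν‖ ≤ ‖((hol (vary F B 1) z (plaqWord μ ν) : (Matrix n n ℂ)ˣ) : Matrix n n ℂ) - 1‖ + 28 * b ^ 2 := by
  have h1 : ((hol F z (plaqWord μ ν) : (Matrix n n ℂ)ˣ) : Matrix n n ℂ) = 1 := by
    have h := hF0 z μ ν hμν
    have : ‖((hol F z (plaqWord μ ν) : (Matrix n n ℂ)ˣ) : Matrix n n ℂ) - 1‖ = 0 := le_antisymm h (norm_nonneg _)
    exact sub_eq_zero.mp (norm_eq_zero.mp this)
  have hT := norm_hol_taylor_le hF hB z μ ν 0 1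
  rw [vary_zero, h1] at hT
  simp only [sub_zero, one_smul, mul_one, one_pow] at hT
  have hb := bondSqAt_le_of_sup hBb z μ ν
  -- ‖c‖ ≤ ‖(h − 1) − c‖ + ‖h − 1‖
  have htri : ‖curlAt F B z μ ν‖
      ≤ ‖((hol (vary F B 1) z (plaqWord μ ν) : (Matrix n n ℂ)ˣ) : Matrix n n ℂ) - 1 - curlAt F B z μ ν‖
        + ‖((hol (vary F B 1) z (plaqWord μ ν) : (Matrix n n ℂ)ˣ) : Matrix n n ℂ) - 1‖ := by
    have := norm_sub_le (((hol (vary F B 1) z (plaqWord μ ν) : (Matrix n n ℂ)ˣ) : Matrix n n ℂ) - 1)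
      (((hol (vary F B 1) z (plaqWord μ ν) : (Matrix n n ℂ)ˣ) : Matrix n n ℂ) - 1 - curlAt F B z μ ν)
    rw [sub_sub_cancel] at this
    linarith [norm_sub_rev (((hol (vary F B 1) z (plaqWord μ ν) : (Matrix n n ℂ)ˣ) : Matrix n n ℂ) - 1 - curlAt F B z μ ν)
      (((hol (vary F B 1) z (plaqWord μ ν) : (Matrix n n ℂ)ˣ) : Matrix n n ℂ) - 1)]
  linarith

/-- The dressed curl of a uniformly bounded field: `‖(d_V X)(p′)‖ ≤ 4q` for `‖X‖ ≤ q`. [folklore] -/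
theorem norm_curlAt_le_four_mul {V : Site d → Fin d → (Matrix n n ℂ)ˣ} (hV : IsUnitaryCfg V) {X : Site d → Fin d → Matrix n n ℂ} {q : ℝ}
    (hX : ∀ y κ, ‖X y κ‖ ≤ q) (z : Site d) (μ ν : Fin d) : ‖curlAt V X z μ ν‖ ≤ 4 * q := by
  have h := norm_curlAt_le hV X z μ ν
  linarith [hX z μ, hX (z + e μ) ν, hX (z + e ν) μ, hX z ν]

/-! ## §2 The coarse curvature letter -/

/-- **THE COARSE CURVATURE LETTER ĝ OF F38's BUNDLE, IN KERNEL.**  `L ≥ 2`; `F̃` unitary `(L^{k+1}·N)`-periodic in the multi-level class radius `x`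
(`LevelSmall d L (k+1) x`, the curvature line `curvSum d L (k+1) x ≤ (2∕3)L`) whose `(k+1)`-fold average `F := cavgIter L (k+1) F̃` is FLAT; `A` skew
`(L^{k+1}·N)`-periodic with `‖A‖ ≤ α₀` in row NE3's quadratic-remainder regime `4(3+12d)²L^{k+1}α₀ ≤ rho0²`; and the averaged representative is
`β′`-small: `SmallField (cavgIter L (k+1) (F̃e^{A})) β′`.  Then the COARSE CURVATURE of the linearised average `φ = D_{F̃}A` obeys, at every coarse
plaquette, `‖(d_F φ)(P)‖ ≤ β′ + 28·(c_D·Mα₀ + C₂(Mα₀)²)² + 4·C₂(Mα₀)²`, `M = L^{k+1}`, `c_D = 3 + 12d`, `C₂ = 4(3+12d)³∕rho0²` — i.e. `ĝ = β′ + c″α̂²`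
with `α̂ = Mα₀`, k-UNIFORM.  PROOF: the log-coordinate `B := relIter L (k+1) F̃ A` of the averaged representative against `F`
(`cavgIter_vary_eq_vary_relIter_of_tower`) is within `C₂(Mα₀)²` of `φ` (`norm_relIter_sub_dirIter_le`, [Balaban1985Averaging] Prop. 4 TYPE) and
`‖φ‖ ≤ c_D·Mα₀` (`norm_dirIter_le_sup`); §1 at the flat `F` turns `β′` into a bound on `d_F B`, and `d_F φ = d_F B − d_F(B − φ)`. [folklore] -/
theorem coarseCurl_le [Nonempty n] {L N : ℕ} [NeZero N] (hL : 2 ≤ L) (k : ℕ) {Ft : Site d → Fin d → (Matrix n n ℂ)ˣ}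
    (hFt : IsUnitaryCfg Ft) (hFtP : IsPeriodicCfg Ft ((L ^ (k + 1) * N : ℕ) : ℤ)) (hFt0 : SmallField Ft 0)
    (hF0 : SmallField (cavgIter L (k + 1) Ft) 0)
    {A : Site d → Fin d → Matrix n n ℂ} (hA : IsSkewDir A) (hAP : IsPeriodicDir A ((L ^ (k + 1) * N : ℕ) : ℤ)) {α₀ : ℝ} (hα₀ : 0 ≤ α₀)
    (hAα : ∀ y μ, ‖A y μ‖ ≤ α₀) (hreg : 4 * (3 + 12 * (d : ℝ)) ^ 2 * (L : ℝ) ^ (k + 1) * α₀ ≤ rho0 d L ^ 2)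
    {β' : ℝ} (hD : SmallField (cavgIter L (k + 1) (vary Ft A 1)) β')
    (c : Site d) {μ ν : Fin d} (hμν : μ ≠ ν) :
    ‖curlAt (cavgIter L (k + 1) Ft) (dirIter L (k + 1) Ft A) c μ ν‖
      ≤ β' + 28 * ((3 + 12 * (d : ℝ)) * ((L : ℝ) ^ (k + 1) * α₀) + 4 * (3 + 12 * (d : ℝ)) ^ 3 / rho0 d L ^ 2 * ((L : ℝ) ^ (k + 1) * α₀) ^ 2) ^ 2
        + 4 * (4 * (3 + 12 * (d : ℝ)) ^ 3 / rho0 d L ^ 2 * ((L : ℝ) ^ (k + 1) * α₀) ^ 2) := by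
  have hL1 : 1 ≤ L := by omega
  have hLr : (0 : ℝ) ≤ L := by positivity
  have hx : (0 : ℝ) ≤ 0 := le_rfl
  have hs : LevelSmall d L (k + 1) 0 := levelSmall_zero L (k + 1)
  have hs' : LevelSmall d L k 0 := levelSmall_zero L k
  have hcurv : curvSum d L (k + 1) 0 ≤ 2 / 3 * L := by rw [curvSum_zero]; positivity
  set F := cavgIter L (k + 1) Ft with hFdef
  set φ := dirIter L (k + 1) Ft A with hφ
  set B := relIter L (k + 1) Ft A with hBdef
  set q : ℝ := 4 * (3 + 12 * (d : ℝ)) ^ 3 / rho0 d L ^ 2 * ((L : ℝ) ^ (k + 1) * α₀) ^ 2 with hq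
  set b₀ : ℝ := (3 + 12 * (d : ℝ)) * ((L : ℝ) ^ (k + 1) * α₀) with hb₀
  -- `F` is unitary
  have hFu : IsUnitaryCfg F := (levelData hL1 hFt hx hs hFt0 (m := k + 1) (by omega)).1
  -- the log-coordinate of the averaged representative and its quadratic remainder (row NE3, Π-C-3b)
  have hvary : cavgIter L (k + 1) (vary Ft A 1) = vary F B 1 :=
    cavgIter_vary_eq_vary_relIter_of_tower hL hFt hFtP hx hs hFt0 hcurv hA hAP hα₀ hAα hreg le_rfl
  have hBs : IsSkewDir B := relIter_skew_of_tower hL hFt hFtP hx hs hFt0 hcurv hA hAP hα₀ hAα hreg le_rfl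
  have hquad : ∀ (z : Site d) (κ : Fin d), ‖B z κ - φ z κ‖ ≤ q := fun z κ =>
    norm_relIter_sub_dirIter_le hL hFt hFtP hx hs hFt0 hcurv hA hAP hα₀ hAα hreg (k + 1) le_rfl z κ
  -- the k-uniform sup letter of the linearised average (row NE3, Π-C-1)
  have htow : ((tower L N (k + 1) : ℕ) : ℤ) = ((L ^ (k + 1) * N : ℕ) : ℤ) := by rw [tower_eq, mul_comm]
  have hFtP' : IsPeriodicCfg Ft ((tower L N (k + 1) : ℕ) : ℤ) := by rw [htow]; exact hFtP
  have hAP' : IsPeriodicDir A ((tower L N (k + 1) : ℕ) : ℤ) := by rw [htow]; exact hAP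
  have hcurv' : curvSum d L (k + 1) 0 ≤ 2 / 3 * L := hcurv
  have hsup : ∀ (z : Site d) (κ : Fin d), ‖φ z κ‖ ≤ b₀ := fun z κ => by
    have h := norm_dirIter_le_sup hL k hFt hFtP' hx hs' hFt0 hA hAP' hα₀ hAα hcurv' z κ
    rw [hb₀]; linarith
  -- the sup of `B`
  have hBb : ∀ (z : Site d) (κ : Fin d), ‖B z κ‖ ≤ b₀ + q := fun z κ => by
    have h1 : ‖B z κ‖ ≤ ‖B z κ - φ z κ‖ + ‖φ z κ‖ := by
      have := norm_add_le (B z κ - φ z κ) (φ z κ); rwa [sub_add_cancel] at this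
    linarith [hquad z κ, hsup z κ]
  -- the plaquette of the averaged representative read through the log-coordinate
  have hhol : ‖((hol (vary F B 1) c (plaqWord μ ν) : (Matrix n n ℂ)ˣ) : Matrix n n ℂ) - 1‖ ≤ β' := by
    rw [← hvary]; exact hD c μ ν hμν
  -- the two pieces
  have hcB : ‖curlAt F B c μ ν‖ ≤ β' + 28 * (b₀ + q) ^ 2 :=
    (norm_curlAt_flat_le_hol_sub_one hFu hF0 hBs hBb c hμν).trans (by linarith)
  have hcD : ‖curlAt F (fun y κ => B y κ - φ y κ) c μ ν‖ ≤ 4 * q := norm_curlAt_le_four_mul hFu hquad c μ ν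
  have hsplit : curlAt F φ c μ ν = curlAt F B c μ ν - curlAt F (fun y κ => B y κ - φ y κ) c μ ν := by
    have hφB : φ = B + fun y κ => -(B y κ - φ y κ) := by funext y κ; simp
    conv_lhs => rw [hφB]
    rw [curlAt_add]
    have hneg : (fun y κ => -(B y κ - φ y κ)) = (-1 : ℝ) • fun y κ => B y κ - φ y κ := by funext y κ; simp
    rw [hneg, NE3EnergyHessBilin.curlAt_smul]
    simp [sub_eq_add_neg]
  rw [hsplit]
  calc ‖curlAt F B c μ ν - curlAt F (fun y κ => B y κ - φ y κ) c μ ν‖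
      ≤ ‖curlAt F B c μ ν‖ + ‖curlAt F (fun y κ => B y κ - φ y κ) c μ ν‖ := norm_sub_le _ _
    _ ≤ β' + 28 * (b₀ + q) ^ 2 + 4 * q := add_le_add hcB hcD

/-! ## §3 The averaged representative is as small as the datum -/

/-- **THE AVERAGED REPRESENTATIVE IS A GAUGE TRANSFORM OF THE DATUM, HENCE AS SMALL**: `U` unitary in the multi-level class radius `x` at level
`k+1` with `(k+1)`-fold average `D`, `SmallField D β′`, `u` unitary ⟹ `SmallField (cavgIter L (k+1) (U^u)) β′` ([tree] `cavgIter_gaugeAct`,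
`smallField_gaugeAct`).  With `U^u = F̃e^{A}` this is the hypothesis `hD` of `coarseCurl_le`. [folklore] -/
theorem smallField_cavgIter_gaugeAct [Nonempty n] {L : ℕ} (hL : 1 ≤ L) (k : ℕ) {U D : Site d → Fin d → (Matrix n n ℂ)ˣ} {x β' : ℝ}
    (hU : IsUnitaryCfg U) (hx : 0 ≤ x) (hs : LevelSmall d L k x) (hUx : SmallField U x) (havg : cavgIter L (k + 1) U = D)
    (hD : SmallField D β') {u : Site d → (Matrix n n ℂ)ˣ} (hu : ∀ y, u y ∈ unitaryUnits (Matrix n n ℂ)) :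
    SmallField (cavgIter L (k + 1) (gaugeAct u U)) β' := by
  rw [NE3CpushGaugeCovariance.cavgIter_gaugeAct hL k hU hx hs hUx hu, havg]
  exact BlockAverageCurrent.smallField_gaugeAct (fun z => hu _) hD

end

end Summit.QuantumFields.BalabanUV.T4Continuum.NE7CoarseCurvatureLetter
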